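/-
Copyright (c) 2026 the pub-hodgecm-mathlib formalisation cell (harness21).  Prover seat hodgecm-mathlib-B-p04 (g48); LH4-plan (g7) WORD #10 DEAL (h′) «LOCALFIELDS GATE (I4), part L2»,
2026-09-02.  The 2-free sequel of FILE 5 ★ `UnramifiedQuadraticNormQuadraticCount` (A-p03 g24) of B-p10's story `UnramifiedQuadraticNorm*`.
-/
import Literature.NumberTheory.LocalFields.UnramifiedQuadraticNormQuadraticCount
import HarnessLib

/-!
# Counting pairs `(u, x)`, `x` ANTI-FIXED, with `a(x)·N(u)² + d(x)·N(u) + p(x) ≡ 0 (mod 𝔪^k)` — the 2-FREE core of the residue-pair counts (no `|2| = 1`)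

Topic `NumberTheory/LocalFields`, namespace `Literature.NumberTheory.LocalFields.UnramifiedQuadraticNorm`.  THEOREMS ONLY: no definition, no named fact, no instance, no notation,
no `sorry`; kernel lane `--supports stmt-HodgeConjecture-24833`.  Cell `pub/hodgecm-mathlib` (D-0151), crux H413; LH4-plan (g7) WORD #10 (C3) RULINGS, deal (h′) = the LocalFields GATE
(I4) of F0P3a-p09's CENSUS-C3 `BorelCountsTrace` (9b5d3560) §4: the trace-frame (D-UNR) type-(1) column needs the residue-pair count of a NORM-FORM congruence over ANTI-FIXED `x̄`
WITHOUT the symmetric-frame token `isUnit_one_sub_sq (h2 : IsUnit 2)` of ★ `natCard_pairs_norm_quadratic_eq` (:262).  THIS FILE (LH4-plan WORD #17 «file the core as its own file») is the shape-independent CORE: ★ §1–§2 of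
`…QuadraticCount` re-run with a GENERAL unit leading coefficient `a` in place of `1 − x²` and with coefficients `a(x), d(x), p(x)` that may DEPEND on the anti-fixed class `x`
(arbitrary functions `R ⧸ 𝔪^m → R ⧸ 𝔪^m`, constrained only after reduction to `R ⧸ 𝔪^k`); the unit-ness of a NORM `w·σw` from `w + σw ∈ A^×` (the trace frame's `b + σb = 1`)
replaces `(1+x) + (1−x) = 2`.  The norm-form head `natCard_pairs_norm_form_eq` (the (C3b) shape `|N(n·w + c₁) − c₂| ≤ |ϖ|^k`) is its instance and lands in the sequel `…NormFormCount.lean` (importing this file)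
once F0P3a-p09's (C3b) normal form is posted (LH4-plan WORD #10 R3).  The second coordinate is offered in BOTH currencies — ANTI-FIXED `x̄` (★ :262's) and FIXED `ȳ`
(LH7-p02's frame currency `x = y·g`, FINDING #13) — each class set has `q^m` elements (★ `natCard_antifixed_quotient_pow` ∕ ★ `natCard_fixed_quotient_pow`).
HONEST LABEL: HC_CM is proved only modulo the 7 printed citations (2 remaining named inputs: hLiu418 = stmt-HodgeConjecture-24832, h413 = stmt-HodgeConjecture-24833) until rung 0
closes; finite commutative algebra, count-neutral ((D-UNR) PRINT by D74′; pays no organ, opens no road).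

THE MATHEMATICS [Flicker1998UnitaryFL, Prop. 10 p. 86 — the residue-characteristic-free form of «`Δ` is uniquely determined … hence `uū ∈ R^×∕(1+π^{m−ν′}R)`»].  Over a commutative
ring `A` (= `R ⧸ 𝔪^k`): for `a, d ∈ A^×` and `p` nilpotent, `E(n) := a·n² + d·n + p` has EXACTLY ONE unit root (existence by the contraction ★ `existsUnique_eq_one_add_mul_mul_sq`
with `ε = a·d⁻²`, `n = −d(aΔ)⁻¹`; uniqueness from `E(n₁) − E(n₂) = (n₁ − n₂)(a(n₁+n₂) + d)` with the bracket `= unit + nilpotent`), and it is `τ`-fixed whenever `τa = a`, `τd = d`,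
`τp = p`.  Hence, for `R` a complete DVR with finite residue field `𝓀` (`#𝓀 = q²`) and an involution `σ` with an anti-symmetric unit: for `1 ≤ k ≤ m` and coefficients whose reductions
mod `𝔪^k` are `σ̄`-fixed with `a, d` units and `p` nilpotent, `#{u ∈ (R ⧸ 𝔪^m)ˣ : a·N(u)² + d·N(u) + p ≡ 0 (mod 𝔪^k)} = q^{m−k}·q^{m−1}(q+1)` (★ (T2) `natCard_norm_congr_quotient_pow`
at the σ-fixed unit lift of the root), and summing over the `q^m` anti-fixed classes `x` (★ `natCard_antifixed_quotient_pow`) with `x`-dependent such coefficients: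
**`#{(u, x) : σ̄x = −x, a(x)N(u)² + d(x)N(u) + p(x) ≡ 0 (mod 𝔪^k)} = q^m · q^{m−k} · q^{m−1}(q+1)`** — the value of ★ :262 VERBATIM.

* §1 `quadratic_root_unique_of_isUnit`, `exists_unit_quadratic_root_of_isUnit`, `quadratic_root_fixed_of_isUnit`, `isUnit_mul_map_of_isUnit_add_map`;
* §2 **`natCard_norm_quadratic_eq_of_isUnit`**, **`natCard_pairs_quadratic_eq_of_isUnit`** (anti-fixed second coordinate), **`natCard_pairs_quadratic_eq_of_isUnit_fixed`** (fixed).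

## References
* [Flicker1998UnitaryFL] Y. Z. Flicker, *Elementary proof of the fundamental lemma for a unitary group*, Canad. J. Math. 50 (1998), 74–98: Prop. 10 p. 86.
* [Serre1979] J.-P. Serre, *Local Fields*, GTM 67 (1979), Ch. V §2 Prop. 3 and Corollary.
-/

set_option autoImplicit false

namespace Literature.NumberTheory.LocalFields.UnramifiedQuadraticNorm

open Literature.LinearAlgebra.Matrix.HermitianFormsHensel Literature.NumberTheory.GaloisRepresentations IsLocalRing

universe u

/-! ## §1 Algebra in a commutative ring `A` (= `R ⧸ 𝔪^k`): the quadratic `a·n² + d·n + p`, `a, d` units, `p` nilpotent -/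

section Algebra

variable {A : Type u} [CommRing A]

/-- **Uniqueness of unit roots**: if `p` is nilpotent, `a` is a unit and `n₁, n₂` are UNIT roots of `E(n) = a·n² + d·n + p`, then `n₁ = n₂`
(`E(n₁) − E(n₂) = (n₁ − n₂)·(a(n₁+n₂) + d)` and `n₂(a·n₂ + d) = −p` makes the bracket `a·n₁ + (nilpotent)`, a unit). [cite: Flicker1998UnitaryFL, Prop. 10 p. 86] -/
theorem quadratic_root_unique_of_isUnit {a d p n₁ n₂ : A} (hp : IsNilpotent p) (ha : IsUnit a) (hn₁ : IsUnit n₁) (hn₂ : IsUnit n₂)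
    (hE₁ : a * n₁ ^ 2 + d * n₁ + p = 0) (hE₂ : a * n₂ ^ 2 + d * n₂ + p = 0) : n₁ = n₂ := by
  obtain ⟨v₂, hv₂⟩ := hn₂
  have hbr : a * n₂ + d = -(p * ↑v₂⁻¹) := by
    have h : n₂ * (a * n₂ + d) = -p := by linear_combination hE₂
    rw [← hv₂] at h ⊢
    calc a * ↑v₂ + d = ↑v₂⁻¹ * (↑v₂ * (a * ↑v₂ + d)) := by rw [← mul_assoc, Units.inv_mul, one_mul]
      _ = -(p * ↑v₂⁻¹) := by rw [h]; ring
  have hnil : IsNilpotent (a * n₂ + d) := by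
    rw [hbr]; exact (Commute.isNilpotent_mul_right (Commute.all _ _) hp).neg
  have hunit : IsUnit (a * (n₁ + n₂) + d) := by
    have e : a * (n₁ + n₂) + d = a * n₁ + (a * n₂ + d) := by ring
    rw [e]
    obtain ⟨w, hw⟩ := ha.mul hn₁
    rw [← hw]
    have : (↑w : A) + (a * n₂ + d) = ↑w * (1 + ↑w⁻¹ * (a * n₂ + d)) := by
      rw [mul_add, mul_one, ← mul_assoc, Units.mul_inv, one_mul]
    rw [this]
    exact (Units.isUnit w).mul (IsNilpotent.isUnit_one_add (Commute.isNilpotent_mul_left (Commute.all _ _) hnil))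
  have hprod : (n₁ - n₂) * (a * (n₁ + n₂) + d) = 0 := by linear_combination hE₁ - hE₂
  exact sub_eq_zero.mp (hunit.mul_left_eq_zero.mp hprod)

/-- **Existence of a unit root** (the contraction step ★ `existsUnique_eq_one_add_mul_mul_sq`): with `p` nilpotent and `a`, `d` units, `E(n) = a·n² + d·n + p` has a unit root —
`n = −d(aΔ)⁻¹` where `Δ = 1 + εpΔ²`, `ε = a·d⁻²` (Flicker's `Δ`, p. 86). [cite: Flicker1998UnitaryFL, Prop. 10 p. 86] -/
theorem exists_unit_quadratic_root_of_isUnit {a d p : A} (hp : IsNilpotent p) (ha : IsUnit a) (hd : IsUnit d) :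
    ∃ n : A, IsUnit n ∧ a * n ^ 2 + d * n + p = 0 := by
  obtain ⟨w, hw⟩ := ha
  obtain ⟨δ, hδ⟩ := hd
  obtain ⟨Δ, hΔ, -⟩ := existsUnique_eq_one_add_mul_mul_sq hp (a * (↑δ⁻¹ : A) ^ 2)
  have hΔu : IsUnit Δ := by
    rw [hΔ]
    exact IsNilpotent.isUnit_one_add
      (Commute.isNilpotent_mul_right (Commute.all _ _) (Commute.isNilpotent_mul_left (Commute.all _ _) hp))
  obtain ⟨Δ', hΔ'⟩ := hΔu
  refine ⟨-(d * (↑w⁻¹ : A) * (↑Δ'⁻¹ : A)), ?_, ?_⟩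
  · exact ((hδ ▸ Units.isUnit δ).mul (Units.isUnit w⁻¹) |>.mul (Units.isUnit Δ'⁻¹)).neg
  · set n : A := -(d * (↑w⁻¹ : A) * (↑Δ'⁻¹ : A)) with hn
    have hwinv : (↑w⁻¹ : A) * a = 1 := by rw [← hw, Units.inv_mul]
    have hΔinv : (↑Δ'⁻¹ : A) * Δ = 1 := by rw [← hΔ', Units.inv_mul]
    have hδinv : d * (↑δ⁻¹ : A) = 1 := by rw [← hδ, Units.mul_inv]
    have key : n * a * Δ = -d := by
      rw [hn]; linear_combination (-(d * ((↑Δ'⁻¹ : A) * Δ))) * hwinv + (-d) * hΔinv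
    have hu : IsUnit (a * Δ ^ 2) := (hw ▸ Units.isUnit w).mul ((hΔ' ▸ Units.isUnit Δ').pow 2)
    refine (hu.mul_left_eq_zero).1 ?_
    have h1 : 1 - Δ = -(a * (↑δ⁻¹ : A) ^ 2 * p * Δ ^ 2) := by linear_combination (-1 : A) * hΔ
    calc (a * n ^ 2 + d * n + p) * (a * Δ ^ 2)
        = (n * a * Δ) ^ 2 + d * Δ * (n * a * Δ) + p * a * Δ ^ 2 := by ring
      _ = d ^ 2 * (1 - Δ) + p * a * Δ ^ 2 := by rw [key]; ring
      _ = p * a * Δ ^ 2 * (1 - (d * (↑δ⁻¹ : A)) ^ 2) := by rw [h1]; ring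
      _ = 0 := by rw [hδinv]; ring

/-- **The unit root is `τ`-fixed** when `τ` is a ring endomorphism with `τa = a`, `τd = d`, `τp = p` (apply `τ` to the equation and use uniqueness).
[cite: Flicker1998UnitaryFL, Prop. 10 p. 86] -/
theorem quadratic_root_fixed_of_isUnit (τ : A →+* A) {a d p n : A} (hp : IsNilpotent p) (ha : IsUnit a) (hn : IsUnit n)
    (hτa : τ a = a) (hτd : τ d = d) (hτp : τ p = p) (hE : a * n ^ 2 + d * n + p = 0) : τ n = n := by
  have hE' : a * (τ n) ^ 2 + d * τ n + p = 0 := by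
    have := congrArg τ hE
    rw [map_add, map_add, map_mul, map_mul, map_pow, hτa, hτd, hτp, map_zero] at this
    exact this
  exact quadratic_root_unique_of_isUnit hp ha (hn.map τ) hn hE' hE

/-- **A NORM `w·τw` IS A UNIT AS SOON AS THE TRACE `w + τw` IS** (`τ` an involution of a LOCAL ring: `τ` preserves non-units, and two non-units do not sum to a unit) — the trace
frame's substitute for ★ `isUnit_one_sub_sq (h2)`: with `b + τb = 1` and `τx = −x`, `w := b + x` has `w + τw = 1`. [cite: Flicker1998UnitaryFL, Prop. 10 p. 86] -/
theorem isUnit_mul_map_of_isUnit_add_map [IsLocalRing A] (τ : A →+* A) (hττ : ∀ y, τ (τ y) = y) {w : A} (h : IsUnit (w + τ w)) :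
    IsUnit (w * τ w) := by
  have hw : IsUnit w := by
    by_contra hnu
    have hm : w ∈ maximalIdeal A := (mem_maximalIdeal _).2 hnu
    have hm' : τ w ∈ maximalIdeal A := by
      refine (mem_maximalIdeal _).2 fun hu => hnu ?_
      have := hu.map τ; rwa [hττ] at this
    exact (mem_maximalIdeal _).1 (Ideal.add_mem _ hm hm') h
  exact hw.mul (hw.map τ)

end Algebra

/-! ## §2 The counts over `R ⧸ 𝔪^m` -/

section Count

variable {R : Type u} [CommRing R] (σ : R →+* R)
variable [IsDomain R] [IsDiscreteValuationRing R] [Finite (ResidueField R)] [IsAdicComplete (maximalIdeal R) R]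
  (hσ : ∀ a, σ (σ a) = a) {a : R} (ha : IsUnit (σ a - a)) {q : ℕ} (hq : Nat.card (ResidueField R) = q ^ 2)

include hσ ha hq in
/-- **Per-coefficient count, 2-free** (Flicker's «`Δ` is uniquely determined modulo `π^{m−ν′}` … hence `uū ∈ R^× ∕ (1 + π^{m−ν′}R)`»): for `1 ≤ k ≤ m` and classes
`a₀ d₀ p₀ ∈ R ⧸ 𝔪^m` whose reductions mod `𝔪^k` are `σ̄_k`-fixed, with `a₀, d₀` units and `p₀` nilpotent there,
`#{u ∈ (R ⧸ 𝔪^m)ˣ : a₀·N(u)² + d₀·N(u) + p₀ ≡ 0 (mod 𝔪^k)} = q^{m−k} · q^{m−1}(q+1)` — ★ `natCard_norm_quadratic_eq` with `(1 − x²) ↦ a₀`, no `IsUnit 2`.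
[cite: Flicker1998UnitaryFL, Prop. 10 p. 86] -/
theorem natCard_norm_quadratic_eq_of_isUnit {k m : ℕ} (hk : 1 ≤ k) (hkm : k ≤ m) (a₀ d₀ p₀ : R ⧸ maximalIdeal R ^ m)
    (ha₀ : IsUnit (Ideal.Quotient.factor (Ideal.pow_le_pow_right hkm) a₀))
    (hσa₀ : Ideal.quotientMap (maximalIdeal R ^ k) σ (maximalIdeal_pow_le_comap σ hσ k) (Ideal.Quotient.factor (Ideal.pow_le_pow_right hkm) a₀) =
      Ideal.Quotient.factor (Ideal.pow_le_pow_right hkm) a₀)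
    (hd₀ : IsUnit (Ideal.Quotient.factor (Ideal.pow_le_pow_right hkm) d₀))
    (hσd₀ : Ideal.quotientMap (maximalIdeal R ^ k) σ (maximalIdeal_pow_le_comap σ hσ k) (Ideal.Quotient.factor (Ideal.pow_le_pow_right hkm) d₀) =
      Ideal.Quotient.factor (Ideal.pow_le_pow_right hkm) d₀)
    (hp₀ : IsNilpotent (Ideal.Quotient.factor (Ideal.pow_le_pow_right hkm) p₀))
    (hσp₀ : Ideal.quotientMap (maximalIdeal R ^ k) σ (maximalIdeal_pow_le_comap σ hσ k) (Ideal.Quotient.factor (Ideal.pow_le_pow_right hkm) p₀) =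
      Ideal.Quotient.factor (Ideal.pow_le_pow_right hkm) p₀) :
    Nat.card {u : R ⧸ maximalIdeal R ^ m // IsUnit u ∧
      Ideal.Quotient.factor (Ideal.pow_le_pow_right hkm)
        (a₀ * (u * Ideal.quotientMap (maximalIdeal R ^ m) σ (maximalIdeal_pow_le_comap σ hσ m) u) ^ 2 +
          d₀ * (u * Ideal.quotientMap (maximalIdeal R ^ m) σ (maximalIdeal_pow_le_comap σ hσ m) u) + p₀) = 0} =
      q ^ (m - k) * (q ^ (m - 1) * (q + 1)) := by
  set σm := Ideal.quotientMap (maximalIdeal R ^ m) σ (maximalIdeal_pow_le_comap σ hσ m) with hσm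
  set σk := Ideal.quotientMap (maximalIdeal R ^ k) σ (maximalIdeal_pow_le_comap σ hσ k) with hσk
  set φ := Ideal.Quotient.factor (S := maximalIdeal R ^ m) (T := maximalIdeal R ^ k) (Ideal.pow_le_pow_right hkm) with hφ
  haveI : Nontrivial (R ⧸ maximalIdeal R ^ k) := nontrivial_quotient_pow (R := R) hk
  haveI : IsLocalRing (R ⧸ maximalIdeal R ^ k) :=
    IsLocalRing.of_surjective' (Ideal.Quotient.mk (maximalIdeal R ^ k)) Ideal.Quotient.mk_surjective
  have hφσ : ∀ y, φ (σm y) = σk (φ y) := fun y => factor_quotientMap σ hσ hkm y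
  -- the unique, σ-fixed unit root `c`, lifted to a σ-fixed unit `r` of `R`
  obtain ⟨c, hcu, hcE⟩ := exists_unit_quadratic_root_of_isUnit hp₀ ha₀ hd₀
  have hσc : σk c = c := quadratic_root_fixed_of_isUnit σk hp₀ ha₀ hcu hσa₀ hσd₀ hσp₀ hcE
  obtain ⟨r₀, hr₀⟩ := Ideal.Quotient.mk_surjective c
  have hmem : σ r₀ - r₀ ∈ maximalIdeal R ^ k := by
    rw [← Ideal.Quotient.eq_zero_iff_mem, map_sub, sub_eq_zero, ← quotientMap_mk σ hσ k, ← hσk, hr₀]; exact hσc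
  obtain ⟨r, hr, hrr⟩ := exists_fixed_sub_mem σ hσ ha hmem
  have hrc : Ideal.Quotient.mk (maximalIdeal R ^ k) r = c := by rw [← hr₀, Ideal.Quotient.eq]; exact hrr
  have hru : IsUnit r := isUnit_of_isUnit_mk_pow hk (by rw [hrc]; exact hcu)
  -- identify the set with the norm fibre over `r̄`
  rw [← natCard_norm_congr_quotient_pow σ hσ ha hq hk hkm hru hr]
  refine Nat.card_congr (Equiv.subtypeEquivRight fun u => ?_)
  have hE : φ (a₀ * (u * σm u) ^ 2 + d₀ * (u * σm u) + p₀) = φ a₀ * (φ (u * σm u)) ^ 2 + φ d₀ * φ (u * σm u) + φ p₀ := by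
    simp only [map_add, map_mul, map_pow]
  show IsUnit u ∧ φ _ = 0 ↔ φ (u * σm u) = _
  constructor
  · rintro ⟨huu, hzero⟩
    rw [hE] at hzero
    have hNu : IsUnit (φ (u * σm u)) := (huu.mul (huu.map σm)).map φ
    rw [quadratic_root_unique_of_isUnit hp₀ ha₀ hNu hcu hzero hcE, ← hrc]
  · intro hNr
    have hNr' : φ (u * σm u) = c := by rw [hNr, hrc]
    refine ⟨?_, by rw [hE, hNr']; exact hcE⟩
    obtain ⟨u₀, rfl⟩ := Ideal.Quotient.mk_surjective u
    have hNu₀ : IsUnit (Ideal.Quotient.mk (maximalIdeal R ^ k) (u₀ * σ u₀)) := by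
      have : φ (Ideal.Quotient.mk (maximalIdeal R ^ m) u₀ * σm (Ideal.Quotient.mk (maximalIdeal R ^ m) u₀)) =
          Ideal.Quotient.mk (maximalIdeal R ^ k) (u₀ * σ u₀) := by
        rw [hσm, quotientMap_mk σ hσ m, ← map_mul, hφ, Ideal.Quotient.factor_mk]
      rw [← this, hNr']; exact hcu
    exact (isUnit_of_mul_isUnit_left (isUnit_of_isUnit_mk_pow hk hNu₀)).map _

include hσ ha hq in
/-- **THE PAIR COUNT, 2-FREE, WITH `x`-DEPENDENT COEFFICIENTS**: for `1 ≤ k ≤ m` and functions `a d p : R ⧸ 𝔪^m → R ⧸ 𝔪^m` such that for every ANTI-FIXED class `x`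
(`σ̄x = −x`) the reductions mod `𝔪^k` of `a x, d x, p x` are `σ̄_k`-fixed with `a x, d x` units and `p x` nilpotent,
`#{(u, x) ∈ (R ⧸ 𝔪^m)ˣ × (R ⧸ 𝔪^m) : σ̄x = −x, a(x)·N(u)² + d(x)·N(u) + p(x) ≡ 0 (mod 𝔪^k)} = q^m · q^{m−k} · q^{m−1}(q+1)` — the value of ★ `natCard_pairs_norm_quadratic_eq`
(the case `a(x) = 1 − x²`, `d, p` constant, `|2| = 1`) VERBATIM, in every residue characteristic. [cite: Flicker1998UnitaryFL, Prop. 10 p. 86] -/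
theorem natCard_pairs_quadratic_eq_of_isUnit {k m : ℕ} (hk : 1 ≤ k) (hkm : k ≤ m) (a d p : R ⧸ maximalIdeal R ^ m → R ⧸ maximalIdeal R ^ m)
    (had : ∀ x : R ⧸ maximalIdeal R ^ m, Ideal.quotientMap (maximalIdeal R ^ m) σ (maximalIdeal_pow_le_comap σ hσ m) x = -x →
      IsUnit (Ideal.Quotient.factor (Ideal.pow_le_pow_right hkm) (a x)) ∧
      Ideal.quotientMap (maximalIdeal R ^ k) σ (maximalIdeal_pow_le_comap σ hσ k) (Ideal.Quotient.factor (Ideal.pow_le_pow_right hkm) (a x)) =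
        Ideal.Quotient.factor (Ideal.pow_le_pow_right hkm) (a x) ∧
      IsUnit (Ideal.Quotient.factor (Ideal.pow_le_pow_right hkm) (d x)) ∧
      Ideal.quotientMap (maximalIdeal R ^ k) σ (maximalIdeal_pow_le_comap σ hσ k) (Ideal.Quotient.factor (Ideal.pow_le_pow_right hkm) (d x)) =
        Ideal.Quotient.factor (Ideal.pow_le_pow_right hkm) (d x) ∧
      IsNilpotent (Ideal.Quotient.factor (Ideal.pow_le_pow_right hkm) (p x)) ∧
      Ideal.quotientMap (maximalIdeal R ^ k) σ (maximalIdeal_pow_le_comap σ hσ k) (Ideal.Quotient.factor (Ideal.pow_le_pow_right hkm) (p x)) =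
        Ideal.Quotient.factor (Ideal.pow_le_pow_right hkm) (p x)) :
    Nat.card {ux : (R ⧸ maximalIdeal R ^ m) × (R ⧸ maximalIdeal R ^ m) //
      Ideal.quotientMap (maximalIdeal R ^ m) σ (maximalIdeal_pow_le_comap σ hσ m) ux.2 = -ux.2 ∧ (IsUnit ux.1 ∧
      Ideal.Quotient.factor (Ideal.pow_le_pow_right hkm)
        (a ux.2 * (ux.1 * Ideal.quotientMap (maximalIdeal R ^ m) σ (maximalIdeal_pow_le_comap σ hσ m) ux.1) ^ 2 +
          d ux.2 * (ux.1 * Ideal.quotientMap (maximalIdeal R ^ m) σ (maximalIdeal_pow_le_comap σ hσ m) ux.1) + p ux.2) = 0)} =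
      q ^ m * (q ^ (m - k) * (q ^ (m - 1) * (q + 1))) := by
  classical
  haveI := CompleteLocalRing.finite_quotient_maximalIdeal_pow (R := R) m
  set σm := Ideal.quotientMap (maximalIdeal R ^ m) σ (maximalIdeal_pow_le_comap σ hσ m) with hσm
  set φ := Ideal.Quotient.factor (S := maximalIdeal R ^ m) (T := maximalIdeal R ^ k) (Ideal.pow_le_pow_right hkm) with hφ
  let P : R ⧸ maximalIdeal R ^ m → Prop := fun x => σm x = -x
  let Q : (R ⧸ maximalIdeal R ^ m) → (R ⧸ maximalIdeal R ^ m) → Prop := fun x u => IsUnit u ∧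
    φ (a x * (u * σm u) ^ 2 + d x * (u * σm u) + p x) = 0
  let X := {x : R ⧸ maximalIdeal R ^ m // P x}
  haveI : Finite X := Subtype.finite
  letI : Fintype X := Fintype.ofFinite X
  -- pairs ≃ Σ x, fibre
  have e : {ux : (R ⧸ maximalIdeal R ^ m) × (R ⧸ maximalIdeal R ^ m) // P ux.2 ∧ Q ux.2 ux.1} ≃ Σ x : X, {u : R ⧸ maximalIdeal R ^ m // Q x.1 u} :=
    { toFun := fun ux => ⟨⟨ux.1.2, ux.2.1⟩, ⟨ux.1.1, ux.2.2⟩⟩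
      invFun := fun y => ⟨(y.2.1, y.1.1), y.1.2, y.2.2⟩
      left_inv := fun ux => rfl
      right_inv := fun y => rfl }
  rw [Nat.card_congr e, Nat.card_sigma]
  have hfib : ∀ x : X, Nat.card {u : R ⧸ maximalIdeal R ^ m // Q x.1 u} = q ^ (m - k) * (q ^ (m - 1) * (q + 1)) := fun x => by
    obtain ⟨h1, h2, h3, h4, h5, h6⟩ := had x.1 x.2
    exact natCard_norm_quadratic_eq_of_isUnit σ hσ ha hq hk hkm (a x.1) (d x.1) (p x.1) h1 h2 h3 h4 h5 h6
  rw [Finset.sum_congr rfl fun x _ => hfib x, Finset.sum_const, smul_eq_mul, Finset.card_univ, ← Nat.card_eq_fintype_card]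
  congr 1
  exact natCard_antifixed_quotient_pow σ hσ ha hq m

include hσ ha hq in
/-- **THE PAIR COUNT IN THE FIXED CURRENCY**: the same with the second coordinate ranging over the FIXED classes `y` (`σ̄y = y`; LH7-p02's frame currency `x = y·g`,
FINDING #13): for `1 ≤ k ≤ m` and functions `a d p : R ⧸ 𝔪^m → R ⧸ 𝔪^m` such that for every FIXED class `y` the reductions mod `𝔪^k` of `a x, d x, p x` are `σ̄_k`-fixed with `a x, d x` units and `p x` nilpotent,
`#{(u, y) ∈ (R ⧸ 𝔪^m)ˣ × (R ⧸ 𝔪^m) : σ̄y = y, a(y)·N(u)² + d(y)·N(u) + p(y) ≡ 0 (mod 𝔪^k)} = q^m · q^{m−k} · q^{m−1}(q+1)` (★ `natCard_fixed_quotient_pow` for the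
`q^m` fixed classes). [cite: Flicker1998UnitaryFL, Prop. 10 p. 86] -/
theorem natCard_pairs_quadratic_eq_of_isUnit_fixed {k m : ℕ} (hk : 1 ≤ k) (hkm : k ≤ m) (a d p : R ⧸ maximalIdeal R ^ m → R ⧸ maximalIdeal R ^ m)
    (had : ∀ x : R ⧸ maximalIdeal R ^ m, Ideal.quotientMap (maximalIdeal R ^ m) σ (maximalIdeal_pow_le_comap σ hσ m) x = x →
      IsUnit (Ideal.Quotient.factor (Ideal.pow_le_pow_right hkm) (a x)) ∧
      Ideal.quotientMap (maximalIdeal R ^ k) σ (maximalIdeal_pow_le_comap σ hσ k) (Ideal.Quotient.factor (Ideal.pow_le_pow_right hkm) (a x)) =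
        Ideal.Quotient.factor (Ideal.pow_le_pow_right hkm) (a x) ∧
      IsUnit (Ideal.Quotient.factor (Ideal.pow_le_pow_right hkm) (d x)) ∧
      Ideal.quotientMap (maximalIdeal R ^ k) σ (maximalIdeal_pow_le_comap σ hσ k) (Ideal.Quotient.factor (Ideal.pow_le_pow_right hkm) (d x)) =
        Ideal.Quotient.factor (Ideal.pow_le_pow_right hkm) (d x) ∧
      IsNilpotent (Ideal.Quotient.factor (Ideal.pow_le_pow_right hkm) (p x)) ∧
      Ideal.quotientMap (maximalIdeal R ^ k) σ (maximalIdeal_pow_le_comap σ hσ k) (Ideal.Quotient.factor (Ideal.pow_le_pow_right hkm) (p x)) =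
        Ideal.Quotient.factor (Ideal.pow_le_pow_right hkm) (p x)) :
    Nat.card {ux : (R ⧸ maximalIdeal R ^ m) × (R ⧸ maximalIdeal R ^ m) //
      Ideal.quotientMap (maximalIdeal R ^ m) σ (maximalIdeal_pow_le_comap σ hσ m) ux.2 = ux.2 ∧ (IsUnit ux.1 ∧
      Ideal.Quotient.factor (Ideal.pow_le_pow_right hkm)
        (a ux.2 * (ux.1 * Ideal.quotientMap (maximalIdeal R ^ m) σ (maximalIdeal_pow_le_comap σ hσ m) ux.1) ^ 2 +
          d ux.2 * (ux.1 * Ideal.quotientMap (maximalIdeal R ^ m) σ (maximalIdeal_pow_le_comap σ hσ m) ux.1) + p ux.2) = 0)} =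
      q ^ m * (q ^ (m - k) * (q ^ (m - 1) * (q + 1))) := by
  classical
  haveI := CompleteLocalRing.finite_quotient_maximalIdeal_pow (R := R) m
  set σm := Ideal.quotientMap (maximalIdeal R ^ m) σ (maximalIdeal_pow_le_comap σ hσ m) with hσm
  set φ := Ideal.Quotient.factor (S := maximalIdeal R ^ m) (T := maximalIdeal R ^ k) (Ideal.pow_le_pow_right hkm) with hφ
  let P : R ⧸ maximalIdeal R ^ m → Prop := fun x => σm x = x
  let Q : (R ⧸ maximalIdeal R ^ m) → (R ⧸ maximalIdeal R ^ m) → Prop := fun x u => IsUnit u ∧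
    φ (a x * (u * σm u) ^ 2 + d x * (u * σm u) + p x) = 0
  let X := {x : R ⧸ maximalIdeal R ^ m // P x}
  haveI : Finite X := Subtype.finite
  letI : Fintype X := Fintype.ofFinite X
  -- pairs ≃ Σ x, fibre
  have e : {ux : (R ⧸ maximalIdeal R ^ m) × (R ⧸ maximalIdeal R ^ m) // P ux.2 ∧ Q ux.2 ux.1} ≃ Σ x : X, {u : R ⧸ maximalIdeal R ^ m // Q x.1 u} :=
    { toFun := fun ux => ⟨⟨ux.1.2, ux.2.1⟩, ⟨ux.1.1, ux.2.2⟩⟩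
      invFun := fun y => ⟨(y.2.1, y.1.1), y.1.2, y.2.2⟩
      left_inv := fun ux => rfl
      right_inv := fun y => rfl }
  rw [Nat.card_congr e, Nat.card_sigma]
  have hfib : ∀ x : X, Nat.card {u : R ⧸ maximalIdeal R ^ m // Q x.1 u} = q ^ (m - k) * (q ^ (m - 1) * (q + 1)) := fun x => by
    obtain ⟨h1, h2, h3, h4, h5, h6⟩ := had x.1 x.2
    exact natCard_norm_quadratic_eq_of_isUnit σ hσ ha hq hk hkm (a x.1) (d x.1) (p x.1) h1 h2 h3 h4 h5 h6
  rw [Finset.sum_congr rfl fun x _ => hfib x, Finset.sum_const, smul_eq_mul, Finset.card_univ, ← Nat.card_eq_fintype_card]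
  congr 1
  exact natCard_fixed_quotient_pow σ hσ ha hq m

end Count

end Literature.NumberTheory.LocalFields.UnramifiedQuadraticNorm
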